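import Literature.MathematicalPhysics.QuantumFieldTheory.Balaban1983to89.T4BetaFlowWellPosed

/-!
# EriceRemainderEnclosureHistoryAutonomyComparisonGap — (E49f) THE ADVANTAGE OF THE LARGER FUNCTIONAL ACCUMULATES: for `B` ANTITONE in the history and
# `B′ ≥ B` on the box, two box solutions `h` of `B`, `h′` of `B′` from one pin that are ORDERED (`h′ ≤ h`, as (E49a) ∕ (E49c) supply in every uniqueness
# regime of `B`) have a level gap `δ_j = 1∕h′_j² − 1∕h_j²` that is NON-NEGATIVE and NON-DECREASING in the scale and dominates the accumulated excess
# `Σ_{i<j} (B′ − B)(h′(i+1), …)`; a UNIFORM excess `B′ − B ≥ η` on the box gives `1∕h′_j² ≥ 1∕h_j² + j·η` — the larger functional is ahead by at least `j·η`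
# in the recursion variable at scale `j` (quantitative comparison; anti-screening of the functional difference, compare (E48c) for the pin difference)

Cell `pub-balaban`, β-function sub-cell, BINDER row D4 «RemainderConst leaves for Bałaban's split» (`HOME/BINDER-OWNERS.md`; owner lineage `b2b-balaban-beta-an4`;
this file by co-owner #2 lineage `b2b-balaban-beta-d4-p2`, generation 46), β-FLOW TEAM duty (1), FREEZE (0) honoured (def-free; node U2's `MemFlow` ∕ `SeqBox` ∕
`seqBox_shift` BY NAME; imports `T4BetaFlowWellPosed` only — the order `h′ ≤ h` is a displayed hypothesis here, supplied by (E49a) `le_of_functional_le` ∕ (E49c)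
in the uniqueness regimes).  Companion of (E49a) `…HistoryAutonomyComparison`, (E49b) `…ComparisonWitness`, (E49c)∕(E49d) `…ComparisonPerron[Dual]`.

HONEST FRAMING (page 1, verbatim and binding).  *"Discharging BetaPertH makes Bałaban's UV stability UNCONDITIONAL — a real constructive-QFT result; it is
NOT the continuum limit and NOT the Clay problem."*  THIS FILE DISCHARGES NOTHING OF THE KIND.  Elementary real analysis about ABSTRACT functionals with a
displayed sign of the memory — hypotheses, not facts; nothing of Bałaban's (1.22) asserted (the sign of its memory is NOT PRINTED, [I] p. 298; GAPS
G-t4-U2-1∕-2).  Row D4 class UNCHANGED (critical-path width 0; instance 0∕1; D4 DISCHARGE NO DATE).  HONEST DEPENDENCY: continuum YM on T⁴ ⇐ BetaPertH ∧ nine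
spine estimates (0/9 proved); BetaPertH ⇐ (D1) ∧ (D4) ∧ CAP+tail; G-an2-4 gates asym, D1 and NE2/3/4.

THE POINT (census sense (α)).  (E49a)∕(E49c) give the ORDER `h′ ≤ h`; how LARGE is the gap?  One line per scale: `δ_{m+1} − δ_m = B′(h′(m+1), …) −
B(h(m+1), …) = [B′ − B](h′(m+1), …) + [B(h′(m+1), …) − B(h(m+1), …)]`, and the second bracket is `≥ 0` because `h′ ≤ h` entrywise and `B` is antitone.
So the gap never shrinks (§1), dominates the accumulated excess of `B′` over `B` ALONG THE SMALLER TRAJECTORY (§2), and grows at least linearly under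
a uniform excess (§3: `1∕h′_j² ≥ 1∕h_j² + j·η`, `h′_j ≤ (1∕h_j² + j·η)^{-1∕2}`).  For ISOTONE memory the second bracket has the other sign: the gap is
SCREENED (and by (E49b) may even start negative).  NOT claimed: upper bounds on the gap (they need a modulus: `δ_{m+1} − δ_m ≤ sup(B′ − B) + M·sup|h − h′|`).

WHAT IS PROVED ([folklore]; 0 `def`, 0 sorry).  §1 `gap_zero`, `gap_succ`, **`gap_succ_ge_excess`**, **`gap_monotone`**, `gap_nonneg`.  §2 **`excess_sum_le_gap`**.
§3 **`gap_ge_linear`**, **`le_envelope_of_uniform_excess`** (`h′_j ≤ 1∕√(1∕h_j² + j·η)`, `η ≥ 0`).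
-/

noncomputable section
open Finset Set

namespace Summit.QuantumFields.BalabanUV.Beta.EriceRemainderEnclosureHistoryAutonomyComparisonGap

open Literature.MathematicalPhysics.QuantumFieldTheory.Balaban1983to89
open Literature.MathematicalPhysics.QuantumFieldTheory.Balaban1983to89.T4BetaStationary
open Literature.MathematicalPhysics.QuantumFieldTheory.Balaban1983to89.T4BetaFlowWellPosed

variable {B B' : (ℕ → ℝ) → ℝ} {γ p η : ℝ} {h h' : ℕ → ℝ}

/-! ## §1 The level gap of two ordered solutions never shrinks -/

/-- At the pin the gap vanishes: `1∕h′₀² − 1∕h₀² = 0`. [folklore] -/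
theorem gap_zero (hf : MemFlow B p h) (hf' : MemFlow B' p h') : 1 / h' 0 ^ 2 - 1 / h 0 ^ 2 = 0 := by
  rw [hf.1, hf'.1, sub_self]

/-- ONE SCALE: `δ_{m+1} − δ_m = B′(h′(m+1), …) − B(h(m+1), …)`. [folklore] -/
theorem gap_succ (hf : MemFlow B p h) (hf' : MemFlow B' p h') (m : ℕ) :
    (1 / h' (m + 1) ^ 2 - 1 / h (m + 1) ^ 2) - (1 / h' m ^ 2 - 1 / h m ^ 2) =
      B' (fun j => h' (m + 1 + j)) - B (fun j => h (m + 1 + j)) := by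
  rw [hf.2 m, hf'.2 m]; ring

/-- **THE GAP GROWS AT LEAST BY THE EXCESS**: `B` antitone on the box, `h′ ≤ h` box-valued ⟹ `δ_{m+1} − δ_m ≥ (B′ − B)(h′(m+1), …)` — the memory term of `B`
read on the SMALLER history `h′` is larger than on `h`. [folklore] -/
theorem gap_succ_ge_excess (hanti : ∀ u u' : ℕ → ℝ, SeqBox γ u → SeqBox γ u' → (∀ j, u j ≤ u' j) → B u' ≤ B u)
    (hh : SeqBox γ h) (hh' : SeqBox γ h') (hf : MemFlow B p h) (hf' : MemFlow B' p h') (hle : ∀ j, h' j ≤ h j) (m : ℕ) :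
    B' (fun j => h' (m + 1 + j)) - B (fun j => h' (m + 1 + j)) ≤
      (1 / h' (m + 1) ^ 2 - 1 / h (m + 1) ^ 2) - (1 / h' m ^ 2 - 1 / h m ^ 2) := by
  rw [gap_succ hf hf' m]
  linarith [hanti _ _ (seqBox_shift hh' (m + 1)) (seqBox_shift hh (m + 1)) fun j => hle (m + 1 + j)]

/-- **THE GAP IS NON-DECREASING IN THE SCALE** (`B′ ≥ B` on the box, `B` antitone, `h′ ≤ h`): the advantage of the larger functional, once gained, is
never given back — anti-screening of the functional difference. [folklore] -/
theorem gap_monotone (hanti : ∀ u u' : ℕ → ℝ, SeqBox γ u → SeqBox γ u' → (∀ j, u j ≤ u' j) → B u' ≤ B u)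
    (hBB' : ∀ u, SeqBox γ u → B u ≤ B' u) (hh : SeqBox γ h) (hh' : SeqBox γ h') (hf : MemFlow B p h) (hf' : MemFlow B' p h')
    (hle : ∀ j, h' j ≤ h j) : Monotone fun m => 1 / h' m ^ 2 - 1 / h m ^ 2 :=
  monotone_nat_of_le_succ fun m => by
    have h1 := gap_succ_ge_excess hanti hh hh' hf hf' hle m
    have h2 := hBB' _ (seqBox_shift hh' (m + 1))
    linarith

/-- … in particular NON-NEGATIVE at every scale (it vanishes at the pin). [folklore] -/
theorem gap_nonneg (hanti : ∀ u u' : ℕ → ℝ, SeqBox γ u → SeqBox γ u' → (∀ j, u j ≤ u' j) → B u' ≤ B u)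
    (hBB' : ∀ u, SeqBox γ u → B u ≤ B' u) (hh : SeqBox γ h) (hh' : SeqBox γ h') (hf : MemFlow B p h) (hf' : MemFlow B' p h')
    (hle : ∀ j, h' j ≤ h j) (m : ℕ) : 0 ≤ 1 / h' m ^ 2 - 1 / h m ^ 2 := by
  have := gap_monotone hanti hBB' hh hh' hf hf' hle (Nat.zero_le m)
  simp only at this
  rwa [gap_zero hf hf'] at this

/-! ## §2 The gap dominates the accumulated excess along the smaller trajectory -/

/-- **`δ_j ≥ Σ_{i<j} (B′ − B)(h′(i+1), …)`** — the gap at scale `j` is at least the total excess of `B′` over `B` collected along `h′` up to that scale.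
[folklore] -/
theorem excess_sum_le_gap (hanti : ∀ u u' : ℕ → ℝ, SeqBox γ u → SeqBox γ u' → (∀ j, u j ≤ u' j) → B u' ≤ B u)
    (hh : SeqBox γ h) (hh' : SeqBox γ h') (hf : MemFlow B p h) (hf' : MemFlow B' p h') (hle : ∀ j, h' j ≤ h j) :
    ∀ j : ℕ, ∑ i ∈ range j, (B' (fun k => h' (i + 1 + k)) - B (fun k => h' (i + 1 + k))) ≤ 1 / h' j ^ 2 - 1 / h j ^ 2 := by
  intro j
  induction j with
  | zero => rw [sum_range_zero, gap_zero hf hf']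
  | succ m ih =>
    rw [sum_range_succ]
    linarith [gap_succ_ge_excess hanti hh hh' hf hf' hle m]

/-! ## §3 A uniform excess gives a linearly growing gap -/

/-- **UNIFORM EXCESS ⟹ LINEAR GAP**: `B′ ≥ B + η` on the box (`B` antitone, `h′ ≤ h`) ⟹ `1∕h_j² + j·η ≤ 1∕h′_j²` at every scale. [folklore] -/
theorem gap_ge_linear (hanti : ∀ u u' : ℕ → ℝ, SeqBox γ u → SeqBox γ u' → (∀ j, u j ≤ u' j) → B u' ≤ B u)
    (hexc : ∀ u, SeqBox γ u → B u + η ≤ B' u) (hh : SeqBox γ h) (hh' : SeqBox γ h') (hf : MemFlow B p h) (hf' : MemFlow B' p h')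
    (hle : ∀ j, h' j ≤ h j) (j : ℕ) : 1 / h j ^ 2 + (j : ℝ) * η ≤ 1 / h' j ^ 2 := by
  have h1 := excess_sum_le_gap hanti hh hh' hf hf' hle j
  have h2 : (j : ℝ) * η ≤ ∑ i ∈ range j, (B' (fun k => h' (i + 1 + k)) - B (fun k => h' (i + 1 + k))) := by
    have : ∑ _i ∈ range j, η ≤ ∑ i ∈ range j, (B' (fun k => h' (i + 1 + k)) - B (fun k => h' (i + 1 + k))) :=
      sum_le_sum fun i _ => by linarith [hexc _ (seqBox_shift hh' (i + 1))]
    rwa [sum_const, card_range, nsmul_eq_mul] at this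
  linarith

/-- **… SO THE SMALLER TRAJECTORY RUNS UNDER THE `η`-SHIFTED ENVELOPE OF THE LARGER ONE**: `h′_j ≤ 1∕√(1∕h_j² + j·η)` (`η ≥ 0`). [folklore] -/
theorem le_envelope_of_uniform_excess (hanti : ∀ u u' : ℕ → ℝ, SeqBox γ u → SeqBox γ u' → (∀ j, u j ≤ u' j) → B u' ≤ B u)
    (hexc : ∀ u, SeqBox γ u → B u + η ≤ B' u) (hη : 0 ≤ η) (hh : SeqBox γ h) (hh' : SeqBox γ h') (hf : MemFlow B p h)
    (hf' : MemFlow B' p h') (hle : ∀ j, h' j ≤ h j) (j : ℕ) : h' j ≤ 1 / Real.sqrt (1 / h j ^ 2 + (j : ℝ) * η) := by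
  have h1 := gap_ge_linear hanti hexc hh hh' hf hf' hle j
  have hpos : 0 < h j := (hh j).1
  have hS : 0 < 1 / h j ^ 2 + (j : ℝ) * η := by positivity
  calc h' j = 1 / Real.sqrt (1 / h' j ^ 2) := (one_div_sqrt_one_div_sq (hh' j).1).symm
    _ ≤ 1 / Real.sqrt (1 / h j ^ 2 + (j : ℝ) * η) :=
        one_div_le_one_div_of_le (Real.sqrt_pos.mpr hS) (Real.sqrt_le_sqrt h1)

end Summit.QuantumFields.BalabanUV.Beta.EriceRemainderEnclosureHistoryAutonomyComparisonGap

end
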